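import Summits.BirchSwinnertonDyer.BirchSwinnertonDyer.Theorems.EisensteinDepletionAtTwoStarGO2KEtaSignCharacterB
import Summits.BirchSwinnertonDyer.BirchSwinnertonDyer.Theorems.EisensteinDepletionAtTwoStarEtaQuotientParity
import Literature.NumberTheory.EllipticCurves.WeightOneEtaQuotientsProofs
import Mathlib.NumberTheory.ModularForms.Discriminant
import Mathlib.NumberTheory.ModularForms.LevelOne.Basic
import HarnessLib

/-!
# Line `kummer` v7.4, stub K-U `stub_etaSqrt` — part 1 (FORM): the square root of the Eisenstein `η`-quotient times `Δ^m`
# as a weight-`12m` object with a genuine modular-form square (crux `StarGO2Sigma`, stmt-BirchSwinnertonDyer-27046; lead GEN 13)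

From planner p2 GEN 38's `KEta.EtaSign.etaSignCharacter` (tree): an odd power `s` and a holomorphic `v` with
`v² = (∏ η(tτ)^{r_t})^s` and the sign law `v(γτ) = (−1)^{φ_β(γ)/g'} v(τ)` on `Γ₀(N)` (`r_t = N c_t`).  Here (pure analysis over the
tree's Ligozat machinery `isBoundedAtImInfty_etaQuotient_slash`): with `m` large against the cusp orders,
`V := (∏ η(tτ)^{r_t})^s · Δ^{2m} = ∏ η(tτ)^{s r_t + 48m[t=1]}` is a modular form of weight `24m` on `Γ₀(N)` (`etaPowModularForm`),
and `u := v·Δ^m` is holomorphic, nowhere zero, `u² = V`, with `u ∣[12m] γ = (−1)^{|n|} • u` (`etaSqrtFn_*`).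
Nothing here reads `r_an`; `StarGO2Sigma` / E1M / BSD are NOT proved by this file.
-/

set_option linter.dupNamespace false
set_option autoImplicit false

noncomputable section

open Complex Filter Topology Asymptotics
open UpperHalfPlane hiding I
open scoped Real Topology Manifold MatrixGroups ModularForm
open ModularForm CongruenceSubgroup
open Literature.NumberTheory.EllipticCurves.ModularForms Literature.NumberTheory.ModularForms
open Summit.BirchSwinnertonDyer.BirchSwinnertonDyer.Theorems.DepletionAtTwo

namespace Summit.BirchSwinnertonDyer.BirchSwinnertonDyer.Theorems.DepletionAtTwo.KummerSigma.EtaSqrt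

variable {N : ℕ}

/-! ### §1 The shifted exponent vector `r″ = s·r + 48m·[t = 1]` -/

/-- The exponent vector of `(∏ η(tτ)^{r_t})^s · Δ^{2m}`. [folklore] -/
def shiftExp (r : ℕ → ℤ) (s m : ℕ) : ℕ → ℤ := fun t ↦ (s : ℤ) * r t + if t = 1 then 48 * (m : ℤ) else 0

/-- `shiftExp` unfolded. [folklore] -/
theorem shiftExp_apply (r : ℕ → ℤ) (s m : ℕ) (t : ℕ) :
    shiftExp r s m t = (s : ℤ) * r t + if t = 1 then 48 * (m : ℤ) else 0 := rfl

/-- Weight of the shifted vector: `Σ r″ = s·Σ r + 48m`. [folklore] -/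
theorem sum_shiftExp (hN : N ≠ 0) (r : ℕ → ℤ) (s m : ℕ) :
    ∑ t ∈ N.divisors, shiftExp r s m t = (s : ℤ) * ∑ t ∈ N.divisors, r t + 48 * (m : ℤ) := by
  simp only [shiftExp_apply, Finset.sum_add_distrib, ← Finset.mul_sum]
  rw [Finset.sum_ite_eq' N.divisors 1 (fun _ ↦ (48 * (m : ℤ)))]
  rw [if_pos (Nat.one_mem_divisors.mpr hN)]

/-- Ligozat's order of the shifted vector: `O(r″, c) = s·O(r, c) + 48mN`. [folklore] -/
theorem cuspOrder24_shiftExp (hN : N ≠ 0) (r : ℕ → ℤ) (s m : ℕ) (c : ℤ) :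
    cuspOrder24 N (shiftExp r s m) c = (s : ℤ) * cuspOrder24 N r c + 48 * (m : ℤ) * N := by
  simp only [cuspOrder24, shiftExp_apply, add_mul, Finset.sum_add_distrib]
  congr 1
  · rw [Finset.mul_sum]
    exact Finset.sum_congr rfl fun t _ ↦ by ring
  · simp only [ite_mul, zero_mul, Finset.sum_ite_eq', Nat.one_mem_divisors.mpr hN, if_true]
    simp [Nat.div_one]

/-- A crude bound: `|O(r, c)| ≤ Σ |r_t| t² N`. [folklore] -/
theorem abs_cuspOrder24_le (r : ℕ → ℤ) (c : ℤ) :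
    |cuspOrder24 N r c| ≤ ∑ t ∈ N.divisors, |r t| * (t : ℤ) ^ 2 * N := by
  unfold cuspOrder24
  refine (Finset.abs_sum_le_sum_abs _ _).trans (Finset.sum_le_sum fun t ht ↦ ?_)
  have ht0 : 0 < t := Nat.pos_of_mem_divisors ht
  have hgcd : (Int.gcd (t : ℤ) c : ℤ) ≤ t := by
    have h := Int.gcd_dvd_left (t : ℤ) c
    exact Int.le_of_dvd (by exact_mod_cast ht0) h
  have hgcd0 : (0 : ℤ) ≤ (Int.gcd (t : ℤ) c : ℤ) := by positivity
  have hdiv : ((N / t : ℕ) : ℤ) ≤ N := by exact_mod_cast Nat.div_le_self N t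
  rw [abs_mul, abs_mul, abs_of_nonneg (pow_nonneg hgcd0 2), abs_of_nonneg (by positivity : (0 : ℤ) ≤ ((N / t : ℕ) : ℤ))]
  gcongr

/-- With `m := s · Σ |r_t| t² N` every Ligozat order of `r″` is non-negative. [folklore] -/
theorem cuspOrder24_shiftExp_nonneg (hN : N ≠ 0) (r : ℕ → ℤ) (s : ℕ) (c : ℤ) (m : ℕ)
    (hm : (s : ℤ) * ∑ t ∈ N.divisors, |r t| * (t : ℤ) ^ 2 * N ≤ m) :
    0 ≤ cuspOrder24 N (shiftExp r s m) c := by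
  rw [cuspOrder24_shiftExp hN]
  have h1 := abs_cuspOrder24_le (N := N) r c
  have h2 : -(∑ t ∈ N.divisors, |r t| * (t : ℤ) ^ 2 * N) ≤ cuspOrder24 N r c := (abs_le.mp h1).1
  have hN1 : (1 : ℤ) ≤ N := by exact_mod_cast Nat.one_le_iff_ne_zero.mpr hN
  have hm0 : (0 : ℤ) ≤ m := by positivity
  nlinarith

/-! ### §2 The pointwise identity `η-quotient(r″) = (η-quotient(r))^s · Δ^{2m}` -/

/-- `∏ η(tτ)^{r″_t} = (∏ η(tτ)^{r_t})^s · Δ(τ)^{2m}`. [folklore] -/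
theorem etaQuotient_shiftExp (hN : N ≠ 0) (r : ℕ → ℤ) (s m : ℕ) (τ : ℍ) :
    etaQuotient N (shiftExp r s m) τ = etaQuotient N r τ ^ s * ModularForm.discriminant τ ^ (2 * m) := by
  rw [etaQuotient_apply, etaQuotient_apply]
  have hsplit : ∀ t ∈ N.divisors, η ((t : ℂ) * τ) ^ shiftExp r s m t =
      (η ((t : ℂ) * τ) ^ r t) ^ s * (if t = 1 then η ((t : ℂ) * τ) ^ (48 * m) else 1) := by
    intro t ht
    have hne : η ((t : ℂ) * τ) ≠ 0 := eta_natMul_ne_zero (Nat.pos_of_mem_divisors ht) τ.2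
    rw [shiftExp_apply, zpow_add₀ hne, mul_comm (s : ℤ), zpow_mul, zpow_natCast]
    congr 1
    split_ifs with h1
    · rw [show (48 * (m : ℤ)) = ((48 * m : ℕ) : ℤ) by push_cast; ring, zpow_natCast]
    · rw [zpow_zero]
  rw [Finset.prod_congr rfl hsplit, Finset.prod_mul_distrib, Finset.prod_pow,
    Finset.prod_ite_eq' N.divisors 1, if_pos (Nat.one_mem_divisors.mpr hN)]
  congr 1
  rw [ModularForm.discriminant, ← pow_mul, Nat.cast_one, one_mul]
  ring_nf

/-! ### §3 The modular form `V` and the square root `u = v·Δ^m` -/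

/-- **The modular form `V = (∏ η(tτ)^{r_t})^s · Δ^{2m} ∈ M_{24m}(Γ₀(N))`**: `Γ₀(N)`-invariance from the SQUARED sign law of
`v` (`v² = (η-quotient)^s`) and the level-one invariance of `Δ`; holomorphy at the cusps by Ligozat (`m` large).
[cite: Savitt2025, Thm. 1 and Rem. 2] -/
def etaPowModularForm (N : ℕ) [NeZero N] (r : ℕ → ℤ) (s m : ℕ) (v : ℍ → ℂ)
    (hsum : ∑ t ∈ N.divisors, r t = 0)
    (hvsq : ∀ τ : ℍ, v τ ^ 2 = etaQuotient N r τ ^ s)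
    (hvinv : ∀ γ : SL(2, ℤ), γ ∈ Gamma0 N → ∀ τ : ℍ, v (γ • τ) ^ 2 = v τ ^ 2)
    (hm : (s : ℤ) * ∑ t ∈ N.divisors, |r t| * (t : ℤ) ^ 2 * N ≤ m) :
    ModularForm (Gamma0 N) ((24 * m : ℕ) : ℤ) where
  toFun := etaQuotient N (shiftExp r s m)
  slash_action_eq' A hA := by
    obtain ⟨γ, hγ, rfl⟩ := hA
    have hN : N ≠ 0 := NeZero.ne N
    have hΔ : ∀ τ : ℍ, ModularForm.discriminant (γ • τ) = denom γ τ ^ (12 : ℤ) * ModularForm.discriminant τ := by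
      intro τ
      have h := congr_fun (SlashInvariantForm.slash_action_generators_SL2Z ModularForm.discriminant_S_invariant ModularForm.discriminant_T_invariant γ) τ
      rw [SL_slash_apply] at h
      have hd : (denom γ τ : ℂ) ≠ 0 := denom_ne_zero γ τ
      rw [← h, mul_comm, mul_assoc, ← zpow_add₀ hd, neg_add_cancel, zpow_zero, mul_one]
    show etaQuotient N (shiftExp r s m) ∣[((24 * m : ℕ) : ℤ)] γ = etaQuotient N (shiftExp r s m)
    funext τ
    rw [SL_slash_apply, etaQuotient_shiftExp hN, etaQuotient_shiftExp hN, ← hvsq, ← hvsq, hvinv γ hγ, hΔ]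
    have hd : (denom γ τ : ℂ) ≠ 0 := denom_ne_zero γ τ
    rw [mul_pow, ← zpow_natCast (denom γ τ ^ (12 : ℤ)), ← zpow_mul]
    have he : (12 : ℤ) * ((2 * m : ℕ) : ℤ) + -(((24 * m : ℕ) : ℤ)) = 0 := by push_cast; ring
    calc v τ ^ 2 * ((denom γ τ : ℂ) ^ ((12 : ℤ) * ((2 * m : ℕ) : ℤ)) * ModularForm.discriminant τ ^ (2 * m)) *
          (denom γ τ : ℂ) ^ (-(((24 * m : ℕ) : ℤ)))
        = v τ ^ 2 * ModularForm.discriminant τ ^ (2 * m) *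
          ((denom γ τ : ℂ) ^ ((12 : ℤ) * ((2 * m : ℕ) : ℤ)) * (denom γ τ : ℂ) ^ (-(((24 * m : ℕ) : ℤ)))) := by ring
      _ = v τ ^ 2 * ModularForm.discriminant τ ^ (2 * m) := by rw [← zpow_add₀ hd, he, zpow_zero, mul_one]
  holo' := mdifferentiable_etaQuotient N _
  bdd_at_cusps' hcusp := by
    rw [Subgroup.IsArithmetic.isCusp_iff_isCusp_SL2Z] at hcusp
    rw [OnePoint.isBoundedAt_iff_forall_SL2Z hcusp]
    intro γ _
    have hN : N ≠ 0 := NeZero.ne N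
    refine isBoundedAtImInfty_etaQuotient_slash N (NeZero.pos N) (shiftExp r s m) _ ?_ γ
      (cuspOrder24_shiftExp_nonneg hN r s _ m hm)
    rw [sum_shiftExp hN, hsum, mul_zero, zero_add]
    push_cast; ring

/-- The underlying function of `etaPowModularForm`. [folklore] -/
theorem coe_etaPowModularForm (N : ℕ) [NeZero N] (r : ℕ → ℤ) (s m : ℕ) (v : ℍ → ℂ)
    (hsum : ∑ t ∈ N.divisors, r t = 0) (hvsq : ∀ τ : ℍ, v τ ^ 2 = etaQuotient N r τ ^ s)
    (hvinv : ∀ γ : SL(2, ℤ), γ ∈ Gamma0 N → ∀ τ : ℍ, v (γ • τ) ^ 2 = v τ ^ 2)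
    (hm : (s : ℤ) * ∑ t ∈ N.divisors, |r t| * (t : ℤ) ^ 2 * N ≤ m) :
    (etaPowModularForm N r s m v hsum hvsq hvinv hm : ℍ → ℂ) = etaQuotient N (shiftExp r s m) := rfl

/-- **`u = v·Δ^m`**: holomorphic, nowhere zero, `u² = V`, and `u ∣[12m] γ = (−1)^{|n|} • u` whenever `v(γτ) = (−1)^n v(τ)`.
[folklore] -/
theorem etaSqrtFn_props (N : ℕ) [NeZero N] (r : ℕ → ℤ) (s m : ℕ) (v : ℍ → ℂ) (hv : MDiff v)
    (hvsq : ∀ τ : ℍ, v τ ^ 2 = etaQuotient N r τ ^ s) :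
    MDiff (fun τ : ℍ ↦ v τ * ModularForm.discriminant τ ^ m) ∧
    (∀ τ : ℍ, v τ * ModularForm.discriminant τ ^ m ≠ 0) ∧
    (∀ τ : ℍ, (v τ * ModularForm.discriminant τ ^ m) ^ 2 = etaQuotient N (shiftExp r s m) τ) ∧
    (∀ (γ : SL(2, ℤ)) (n : ℤ), (∀ τ : ℍ, v (γ • τ) = (-1 : ℂ) ^ n * v τ) →
      (fun τ : ℍ ↦ v τ * ModularForm.discriminant τ ^ m) ∣[((12 * m : ℕ) : ℤ)] γ =
        ((-1 : ℂ) ^ n.natAbs) • fun τ : ℍ ↦ v τ * ModularForm.discriminant τ ^ m) := by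
  have hN : N ≠ 0 := NeZero.ne N
  have hΔd : MDiff (ModularForm.discriminant : ℍ → ℂ) := CuspForm.discriminant.holo'
  refine ⟨hv.mul (hΔd.pow m), fun τ ↦ ?_, fun τ ↦ ?_, fun γ n hn ↦ ?_⟩
  · refine mul_ne_zero (fun h0 ↦ ?_) (pow_ne_zero _ (discriminant_ne_zero τ))
    have h := hvsq τ
    rw [h0, zero_pow two_ne_zero] at h
    exact pow_ne_zero s (etaQuotient_ne_zero N r τ) h.symm
  · rw [mul_pow, hvsq, etaQuotient_shiftExp hN, ← pow_mul]
    ring_nf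
  · have hΔ : ∀ τ : ℍ, ModularForm.discriminant (γ • τ) = denom γ τ ^ (12 : ℤ) * ModularForm.discriminant τ := by
      intro τ
      have h := congr_fun (SlashInvariantForm.slash_action_generators_SL2Z ModularForm.discriminant_S_invariant ModularForm.discriminant_T_invariant γ) τ
      rw [SL_slash_apply] at h
      have hd : (denom γ τ : ℂ) ≠ 0 := denom_ne_zero γ τ
      rw [← h, mul_comm, mul_assoc, ← zpow_add₀ hd, neg_add_cancel, zpow_zero, mul_one]
    have hsign : (-1 : ℂ) ^ n = (-1 : ℂ) ^ n.natAbs := by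
      rcases Int.natAbs_eq n with h | h
      · conv_lhs => rw [h]
        rw [zpow_natCast]
      · conv_lhs => rw [h]
        rw [zpow_neg, zpow_natCast, ← inv_pow, inv_neg, inv_one]
    funext τ
    rw [SL_slash_apply, Pi.smul_apply, smul_eq_mul, hn τ, hΔ τ, hsign]
    have hd : (denom γ τ : ℂ) ≠ 0 := denom_ne_zero γ τ
    rw [mul_pow, ← zpow_natCast (denom γ τ ^ (12 : ℤ)), ← zpow_mul]
    have he : (12 : ℤ) * (m : ℕ) + -(((12 * m : ℕ) : ℤ)) = 0 := by push_cast; ring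
    calc (-1 : ℂ) ^ n.natAbs * v τ * ((denom γ τ : ℂ) ^ ((12 : ℤ) * (m : ℕ)) * ModularForm.discriminant τ ^ m) *
          (denom γ τ : ℂ) ^ (-(((12 * m : ℕ) : ℤ)))
        = (-1 : ℂ) ^ n.natAbs * (v τ * ModularForm.discriminant τ ^ m) *
          ((denom γ τ : ℂ) ^ ((12 : ℤ) * (m : ℕ)) * (denom γ τ : ℂ) ^ (-(((12 * m : ℕ) : ℤ)))) := by ring
      _ = (-1 : ℂ) ^ n.natAbs * (v τ * ModularForm.discriminant τ ^ m) := by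
          rw [← zpow_add₀ hd, he, zpow_zero, mul_one]

end Summit.BirchSwinnertonDyer.BirchSwinnertonDyer.Theorems.DepletionAtTwo.KummerSigma.EtaSqrt

end
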